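import Summits.BirchSwinnertonDyer.BirchSwinnertonDyer.Theorems.UniversalToricDescentTameLocalTorsionCount
import Summits.BirchSwinnertonDyer.BirchSwinnertonDyer.Theorems.QuadraticBranchSignedControlEtaLayerPackages
import Summits.BirchSwinnertonDyer.Rank1Residual.X12.O11.LocalKernelFiniteAtThreeDischarge
import Summits.BirchSwinnertonDyer.Rank1Residual.Additive.ZpTowerSeam
import HarnessLib

/-!
# Stub R3 `stub_localTorsionCountAtTame` of line `sigmacongruence` (crux ♭T≤ stmt-BirchSwinnertonDyer-23042) — PROVED,
# via FIN: the layer invariants `E[p^∞]^{D_v ∩ Γ_m}` are finite, for every elliptic curve over a number field,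
# every prime `p`, every `ℤ_p`-extension, every finite place `v` and every layer `m`
# (FIN is also the input of R1 (c)/F4/F7 of the lead's relaxed count road)

Width prover `bsd-wall-utd-p1-w2` g2 under lead `bsd-wall-utd-p1` g18 (`--supports stmt-BirchSwinnertonDyer-23042`; registered stub
R3 of skeleton v9 `1bb2faab747a10b8`, verbatim, §4). THEOREMS ONLY (no definition, no named fact, no `sorry`). BSD is not proved by any
of this. R3 = R3′ ∧ FIN: width g1 landed R3′ = `…TameLocalTorsionCount.natCard_pow_torsion_subgroupH1_kerD_le_of_finite_layerFixed`
(p688118: exhaustion + finite-kernel layer descent + tame layer count, GIVEN `hFIN`); this file proves FIN (§2) and closes R3 (§4).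

For `W/K` elliptic over a number field, `p` prime, `κ : Γ_K ↠ ℤ_p`, `v` a finite place with decomposition group
`D_v = decomp v` (the image of `Γ_{K_v}` along the chosen embedding `K̄ → K̄_v`) and `m : ℕ`, the subgroup of `E[p^∞] = E(K̄)[p^∞]`
fixed by the layer `G_m = D_v ∩ κ⁻¹(p^m ℤ_p) = D_v ∩ Γ_{K_m}` is FINITE — it is `E(L)[p^∞]` for the finite extension `L = K_v·K_m`
of `K_v`, a completion of the layer number field `K_m` (Silverman VII.6.3 / Milne ADT I 3.3 at `(K_m)_w`). Width `utd-p1-w2` g1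
reduced R3 to exactly this input (`…TameLocalTorsionCount.natCard_pow_torsion_subgroupH1_kerD_le_of_finite_layerFixed`, hypothesis
`hFIN`); the lead's F4/F7 carry it as the hypothesis `Finite {a : A // ∀ g ∈ Γ_m ⊓ decomp v, g • a = a}`.

Proof (all bricks in the tree): (1) over ANY number field `L`, `E(L_w)[p^∞]` is finite (X12 `finite_primaryComponent_point_adicCompletion`,
VII.6.3) and the `D_w`-fixed points of `E_L[p^∞]` inject into it (X11b `natCard_fixedPoints_decomp_le_natCard_primaryComponent`, Galois
descent); changing the `L`-embedding `L̄ → L̄_w` conjugates `D_w` inside `Γ_L` (`exists_algHom_eq_comp`, `resGalOfEmb_comp_apply`), so the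
points fixed by `range (res_{ι₀})` are finite for EVERY `L`-embedding `ι₀` (§1). (2) For the layer `L = K_m = κ.layer m` (Galois over `K`,
`galRange K_m = κ⁻¹(p^mℤ_p)`, seam `pow_dvd_kappa_resGal_layer`) take the local package `(ι = closureEmb K_v, ι₂, ι')` at `v` of cell
`bsd-potss` (`EtaLayer.exists_package_adicCompletion`: a place `w ∣ v` of `K_m`, `ι₂ : K̄_v ≃ L̄_w`, an `L`-embedding `ι' : L̄ → L̄_w` with
`ι' ∘ ι_L = ι₂ ∘ ι`); `resGal K_m` maps `range (res_{ι'})` INTO `D_v`, and into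
`κ⁻¹(p^mℤ_p)` by the seam (here via the inverse transport `ι₂⁻¹(·)ι₂`, `EtaLayer.resGalOfEmb_transportAut_symm`); so along the `Γ_L`-equivariant coefficient isomorphism `E[p^∞] ≃ E_L[p^∞]` (`primaryBaseChangeEquiv_smul`) a
`G_m`-fixed point of `E[p^∞]` becomes a `range (res_{ι'})`-fixed point of `E_L[p^∞]`, injectively (§2). §3 restates FIN in the
`decomp v ⊓ κ.layerSubgroup m` currencies; §4 is the registered stub R3, verbatim, = R3′ (p688118) fed with FIN at `W := E′_K`, `p := 3`.

References: [SilvermanAEC2009] Prop. VII.6.3, VIII.§1; [MilneADT2006] I Lemma 3.3; [GreenbergLNM1716] §3 Lemma 3.3 (p. 87: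
"the kernel of `γ_v − 1` acting on `B_v` … is `E(F_v)_p`, finite"); [SerreGaloisCohomology1997] II.§1.1; [NeukirchANT1999] II.§8;
[Washington1997] §13.1.
-/

-- `…BirchSwinnertonDyer.BirchSwinnertonDyer…` is the problem's mandated namespace (D-0017 nested layout)
set_option linter.dupNamespace false
set_option autoImplicit false

noncomputable section
open scoped Classical
open Field NumberField IsDedekindDomain Function WeierstrassCurve
open Literature.NumberTheory.EllipticCurves Literature.NumberTheory.EllipticCurves.GreenbergSelmer
open Literature.NumberTheory.GaloisRepresentations

namespace Summit.BirchSwinnertonDyer.BirchSwinnertonDyer.Theorems.UniversalToricDescentLayerFixedFinite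

open Summit.BirchSwinnertonDyer.Rank1Residual.Additive Summit.BirchSwinnertonDyer.Rank1Residual.Additive.ZpTower
  Summit.BirchSwinnertonDyer.Rank1Residual.Additive.LocalTransport
  Summit.BirchSwinnertonDyer.BirchSwinnertonDyer.Theorems.EtaLayer

/-! ## §0 `D_u` is the range of `res_{ι_u}` for the chosen embedding `ι_u = closureEmb K_u` (definitional) -/

/-- `D_u = range (res_{closureEmb K_u})`: `GreenbergSelmer.decomp u` is the range of `absGaloisRestrict K K_u`, which is
`resGalOfEmb (closureEmb K_u)` by definition. [cite: Greenberg1989, §1 p. 98] -/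
theorem mem_decomp_iff_exists_resGalOfEmb {K : Type} [Field K] [NumberField K] (u : HeightOneSpectrum (𝓞 K))
    (δ : absoluteGaloisGroup K) :
    δ ∈ decomp (K := K) u ↔ ∃ σ : absoluteGaloisGroup (u.adicCompletion K),
      resGalOfEmb (closureEmb (K := K) (u.adicCompletion K)) σ = δ :=
  mem_decomp_iff u δ

/-! ## §1 Over any number field: the points of `E_L[p^∞]` fixed by `range (res_{ι₀})` are finite, for every `L`-embedding `ι₀ : L̄ → L̄_w` -/

section AnyEmbedding

variable {L : Type} [Field L] [NumberField L] (W' : WeierstrassCurve L) [W'.IsElliptic] (p : ℕ) [Fact p.Prime]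
  (w : HeightOneSpectrum (𝓞 L))

/-- **`E_L[p^∞]^{res_{ι₀}(Γ_{L_w})}` is finite for EVERY `L`-embedding `ι₀ : L̄ → L̄_w`**: `ι₀ = ι_w ∘ τ` for the chosen embedding
`ι_w` and some `τ ∈ Γ_L`, `res_{ι₀} = τ⁻¹ res_{ι_w} τ`, so `m ↦ τ • m` injects these points into the `D_w`-fixed points, which inject
into the finite group `E(L_w)[p^∞]` (Silverman VII.6.3 + Galois descent). [cite: SilvermanAEC2009, Prop. VII.6.3 and VIII.§1]
[cite: GreenbergLNM1716, §3 Lemma 3.3 (proof, p. 87)] [cite: SerreGaloisCohomology1997, II.§1.1] -/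
theorem finite_fixedBy_resGalOfEmb (ι₀ : AlgebraicClosure L →ₐ[L] AlgebraicClosure (w.adicCompletion L)) :
    Finite {m : W'.geomPrimaryTorsion p //
      ∀ g : absoluteGaloisGroup (w.adicCompletion L), resGalOfEmb ι₀ g • m = m} := by
  haveI := Summit.BirchSwinnertonDyer.Rank1Residual.X12.O11.finite_primaryComponent_point_adicCompletion W' p w
  obtain ⟨hfin, -⟩ :=
    Summit.BirchSwinnertonDyer.Rank1Residual.X11b.AcSelmer.natCard_fixedPoints_decomp_le_natCard_primaryComponent W' p w
  haveI := hfin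
  obtain ⟨τ, rfl⟩ := exists_algHom_eq_comp (closureEmb (K := L) (w.adicCompletion L)) ι₀
  let t : absoluteGaloisGroup L := τ
  refine Finite.of_injective
    (fun m : {m : W'.geomPrimaryTorsion p // ∀ g : absoluteGaloisGroup (w.adicCompletion L),
        resGalOfEmb ((closureEmb (K := L) (w.adicCompletion L)).comp
          (τ : AlgebraicClosure L →ₐ[L] AlgebraicClosure L)) g • m = m} ↦
      (⟨t • (m : W'.geomPrimaryTorsion p), ?_⟩ : FixedPoints.addSubgroup ↥(decomp w) (W'.geomPrimaryTorsion p))) ?_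
  · rw [FixedPoints.mem_addSubgroup]
    rintro ⟨d, hd⟩
    obtain ⟨g, rfl⟩ := (mem_decomp_iff_exists_resGalOfEmb w d).mp hd
    have hm : (t⁻¹ * resGalOfEmb (closureEmb (K := L) (w.adicCompletion L)) g * t) • (m : W'.geomPrimaryTorsion p) = m := by
      have h := m.2 g
      rw [resGalOfEmb_comp_apply] at h
      exact h
    rw [Subgroup.mk_smul]
    change resGalOfEmb (closureEmb (K := L) (w.adicCompletion L)) g • t • (m : W'.geomPrimaryTorsion p) = t • (m : W'.geomPrimaryTorsion p)
    conv_rhs => rw [← hm]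
    rw [← mul_smul, ← mul_smul, ← mul_assoc, ← mul_assoc, mul_inv_cancel, one_mul]
  · intro a b hab
    dsimp only at hab
    have h : t • (a : W'.geomPrimaryTorsion p) = t • (b : W'.geomPrimaryTorsion p) := congrArg Subtype.val hab
    exact Subtype.ext (smul_left_cancel_iff t |>.mp h)

end AnyEmbedding

/-! ## §2 FIN: the layer invariants `E[p^∞]^{D_v ∩ κ⁻¹(p^m ℤ_p)}` are finite -/

section Layer

variable {K : Type} [Field K] [NumberField K] (W : WeierstrassCurve K) [W.IsElliptic] (p : ℕ) [Fact p.Prime]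
  (κ : ZpExtension K p) (v : HeightOneSpectrum (𝓞 K))

/-- **FIN.** For every `m`, the points of `E[p^∞]` fixed by every `d ∈ D_v` with `p^m ∣ κ d` (the layer `G_m = D_v ∩ Γ_{K_m}`) form a
finite set — they are `E(K_v·K_m)[p^∞]`, finite by Silverman VII.6.3 at the completion `(K_m)_w`: transported along the local package
at `v` for the layer field `K_m` and the `Γ_{K_m}`-equivariant `E[p^∞] ≃ E_{K_m}[p^∞]` into §1. This is the hypothesis `hFIN` of
`…TameLocalTorsionCount.natCard_pow_torsion_subgroupH1_kerD_le_of_finite_layerFixed` (R3 = that theorem ∧ FIN).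
[cite: SilvermanAEC2009, Prop. VII.6.3] [cite: GreenbergLNM1716, §3 Lemma 3.3 (proof, p. 87)] [cite: NeukirchANT1999, Ch. II §8]
[cite: Washington1997, §13.1] -/
theorem finite_layerFixed (m : ℕ) :
    Finite {a : W.geomPrimaryTorsion p //
      ∀ d : decomp (K := K) v, (p : ℤ_[p]) ^ m ∣ (κ (d : absoluteGaloisGroup K)).toAdd → (d : absoluteGaloisGroup K) • a = a} := by
  -- the local package at `v` for the Galois layer `K_m` and the chosen `K`-embedding `K̄ → K̄_v`
  obtain ⟨w, hw, ι₂, ι', hcompat, hf, -⟩ :=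
    exists_package_adicCompletion (κ.layer m) v (RingEquiv.refl _) (fun _ ↦ rfl) (closureEmb (K := K) (v.adicCompletion K))
  haveI := hw
  haveI hSL := finite_fixedBy_resGalOfEmb (W.baseChange (κ.layer m)) p w ι'
  let e := primaryBaseChangeEquiv (κ.layer m) W p
  refine Finite.of_injective
    (fun a : {a : W.geomPrimaryTorsion p // ∀ d : decomp (K := K) v,
        (p : ℤ_[p]) ^ m ∣ (κ (d : absoluteGaloisGroup K)).toAdd → (d : absoluteGaloisGroup K) • a = a} ↦
      (⟨e (a : W.geomPrimaryTorsion p), fun g ↦ ?_⟩ :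
        {m' : (W.baseChange (κ.layer m)).geomPrimaryTorsion p //
          ∀ g : absoluteGaloisGroup (w.adicCompletion (κ.layer m)), resGalOfEmb ι' g • m' = m'})) ?_
  · -- `σ = res_{ι'} g ∈ Γ_{K_m}` restricts INTO `D_v` (package) and into `κ⁻¹(p^m ℤ_p)` (seam)
    have hmem : resGal (K := K) (κ.layer m) (resGalOfEmb (K := κ.layer m) ι' g) ∈ decomp (K := K) v := by
      rw [mem_decomp_iff_exists_resGalOfEmb]
      exact ⟨transportAut ι₂.symm g
          (fix_symm ι₂ ((adicCompletionMap (K := K) (κ.layer m) v w).comp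
            (RingEquiv.refl (v.adicCompletion K)).symm.toRingHom) hf g),
        resGalOfEmb_transportAut_symm (κ.layer m) (closureEmb (K := K) (v.adicCompletion K)) ι₂ ι' hcompat g _⟩
    have ha : resGal (K := K) (κ.layer m) (resGalOfEmb (K := κ.layer m) ι' g) • (a : W.geomPrimaryTorsion p) = a :=
      a.2 ⟨_, hmem⟩ (pow_dvd_kappa_resGal_layer κ m _)
    have h := primaryBaseChangeEquiv_smul (κ.layer m) W p (resGalOfEmb (K := κ.layer m) ι' g) (a : W.geomPrimaryTorsion p)
    rw [Subgroup.smul_def, coe_resGalToRange, ha] at h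
    exact h.symm
  · intro a b hab
    dsimp only at hab
    exact Subtype.ext (e.injective (congrArg Subtype.val hab))

/-! ## §3 The same in the `decomp v ⊓ κ.layerSubgroup m` currencies (lead's F4/F7 hypothesis shape) -/

/-- FIN, membership form: the points of `E[p^∞]` fixed by every `g ∈ decomp v ⊓ κ.layerSubgroup m` are finite.
[cite: SilvermanAEC2009, Prop. VII.6.3] [cite: Washington1997, §13.1] -/
theorem finite_fixedBy_decomp_inf_layerSubgroup (m : ℕ) :
    Finite {a : W.geomPrimaryTorsion p // ∀ g ∈ decomp (K := K) v ⊓ κ.layerSubgroup m, g • a = a} := by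
  haveI := finite_layerFixed W p κ v m
  refine Finite.of_injective
    (fun a : {a : W.geomPrimaryTorsion p // ∀ g ∈ decomp (K := K) v ⊓ κ.layerSubgroup m, g • a = a} ↦
      (⟨(a : W.geomPrimaryTorsion p), fun d hd ↦ a.2 _ (Subgroup.mem_inf.mpr ⟨d.2, ZpExtension.mem_layerSubgroup.mpr hd⟩)⟩ :
        {a : W.geomPrimaryTorsion p // ∀ d : decomp (K := K) v,
          (p : ℤ_[p]) ^ m ∣ (κ (d : absoluteGaloisGroup K)).toAdd → (d : absoluteGaloisGroup K) • a = a})) ?_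
  intro a b hab
  dsimp only at hab
  exact Subtype.ext (Subtype.mk.inj hab)

/-- FIN, with the factors the other way round (`κ.layerSubgroup m ⊓ decomp v`, the lead's F4 shape
`Finite {a : A // ∀ g ∈ Γ_m ⊓ decomp v, g • a = a}`). [cite: SilvermanAEC2009, Prop. VII.6.3] [cite: Washington1997, §13.1] -/
theorem finite_fixedBy_layerSubgroup_inf_decomp (m : ℕ) :
    Finite {a : W.geomPrimaryTorsion p // ∀ g ∈ κ.layerSubgroup m ⊓ decomp (K := K) v, g • a = a} := by
  rw [inf_comm]
  exact finite_fixedBy_decomp_inf_layerSubgroup W p κ v m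

/-- FIN, fixed-points-subgroup form: `FixedPoints.addSubgroup ↥(decomp v ⊓ κ.layerSubgroup m) E[p^∞]` is finite.
[cite: SilvermanAEC2009, Prop. VII.6.3] [cite: Washington1997, §13.1] -/
theorem finite_fixedPoints_decomp_inf_layerSubgroup (m : ℕ) :
    Finite (FixedPoints.addSubgroup ↥(decomp (K := K) v ⊓ κ.layerSubgroup m) (W.geomPrimaryTorsion p)) := by
  haveI := finite_fixedBy_decomp_inf_layerSubgroup W p κ v m
  refine Finite.of_injective
    (fun a : FixedPoints.addSubgroup ↥(decomp (K := K) v ⊓ κ.layerSubgroup m) (W.geomPrimaryTorsion p) ↦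
      (⟨(a : W.geomPrimaryTorsion p), fun g hg ↦ ?_⟩ :
        {a : W.geomPrimaryTorsion p // ∀ g ∈ decomp (K := K) v ⊓ κ.layerSubgroup m, g • a = a})) ?_
  · have h := (FixedPoints.mem_addSubgroup _ _ _).mp a.2 ⟨g, hg⟩
    rwa [Subgroup.mk_smul] at h
  · intro a b hab
    dsimp only at hab
    exact Subtype.ext (Subtype.mk.inj hab)

end Layer

end Summit.BirchSwinnertonDyer.BirchSwinnertonDyer.Theorems.UniversalToricDescentLayerFixedFinite

/-! ## §4 The registered stub R3 `stub_localTorsionCountAtTame` (skeleton v9, verbatim) -/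

namespace Summit.BirchSwinnertonDyer.BirchSwinnertonDyer.Cruxes.DefectTransportModThreePT.SigmaCongruence

open Summit.BirchSwinnertonDyer.Rank1Residual Summit.BirchSwinnertonDyer.Rank1Residual.X11b
  Summit.BirchSwinnertonDyer.Rank1Residual.X11b.AcSelmer Summit.BirchSwinnertonDyer.Rank1Residual.X11b.Coinv
  Summit.BirchSwinnertonDyer.BirchSwinnertonDyer.Theorems

/-- **STUB R3 (v9) — PROVED**: at a tame place `v ∤ 3` finitely decomposed in the `ℤ₃`-extension `κ` (`D_v ⊄ ker κ`), for every `k`,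
`#H¹(kerD κ v, E′_K[3^∞])[3^k] ≤ #E′_K[3^∞]^{kerD κ v}[3^k]` — width g1's R3′
(`UniversalToricDescentTameLocalTorsionCount.natCard_pow_torsion_subgroupH1_kerD_le_of_finite_layerFixed`: exhaustion of the finite
`H¹(kerD, A)[3^k]` by a stabiliser layer, finite-kernel layer descent, Tate's tame layer count `#H¹(G_n, A)[3^k] ≤ #A^{G_n}[3^k]`,
`A^{G_n} ≤ A^{kerD}`) fed with FIN (`UniversalToricDescentLayerFixedFinite.finite_layerFixed`, §2) at `W := E′.baseChange K`, `p := 3`.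
[cite: GreenbergVatsal2000, §2 Prop. (2.4) and proof (arXiv p. 22)] [cite: GreenbergLNM1716, §3 Lemma 3.3 (proof, p. 87)]
[cite: MilneADT2006, Ch. I, Thm. 2.8, Cor. 2.3] [cite: SilvermanAEC2009, Prop. VII.6.3] -/
theorem stub_localTorsionCountAtTame :
    ∀ (W' : WeierstrassCurve ℚ) [W'.IsElliptic] (K : Type) [Field K] [NumberField K] (κ : ZpExtension K 3)
      (v : HeightOneSpectrum (𝓞 K)), ((3 : ℕ) : 𝓞 K) ∉ v.asIdeal → ¬ (decomp v ≤ κ.kerSubgroup) →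
      ∀ k : ℕ, Nat.card {f : subgroupH1 (kerD κ v) ((W'.baseChange K).geomPrimaryTorsion 3) // 3 ^ k • f = 0} ≤
        Nat.card {a : (W'.baseChange K).geomPrimaryTorsion 3 //
          (∀ g : kerD κ v, ((g : decomp (K := K) v) : absoluteGaloisGroup K) • a = a) ∧ 3 ^ k • a = 0} := by
  intro W' _ K _ _ κ v hv hvd k
  exact UniversalToricDescentTameLocalTorsionCount.natCard_pow_torsion_subgroupH1_kerD_le_of_finite_layerFixed
    (W'.baseChange K) 3 κ v hv hvd (UniversalToricDescentLayerFixedFinite.finite_layerFixed (W'.baseChange K) 3 κ v) k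

end Summit.BirchSwinnertonDyer.BirchSwinnertonDyer.Cruxes.DefectTransportModThreePT.SigmaCongruence

end
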